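import Mathlib
import Summits.ValiantsHypothesis.ValiantsHypothesis.Theorems.KPlusLogSqLawWeakLiftingTowerGraftSkewBlockCrossings
import Summits.ValiantsHypothesis.ValiantsHypothesis.Theorems.KPlusLogSqLawWeakLiftingTowerGraftSkewBlockIdentityGraftSharp

/-!
# Tower graft line — CORNER-GRAFT PHANTOMS FROM ROOT COUNTING ALONE: the unipotent column mixing (S4b's object)

Calibration file for the line `Cruxes/WeakLifting/Lines/tower_graft.lean` (crux `WeakLifting` = stmt-ValiantsHypothesis-19561), object of S4b
`stub_graftLawCorner` (the CORNER graft `det(G + X^D·Eᵢᵢ) = det G + X^D·det Gᵢᵢ`).  NO stub is claimed.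

The identity-graft row of the NO-GO ledger went kernel by ROOT COUNTING ALONE (p706281 `skewBlock_identityGraft_of_sharp`: Descartes-sharp
`det B` ⇒ simple roots ⇒ corank one ⇒ SOME column of `B(ρ)` can be deleted keeping full column rank, p704766), because the identity graft
accepts a different surviving column at each root.  The CORNER graft pins the deleted column to the corner index `j` (p689545
`skewBlock_phantoms_square`, hypothesis `hρB″`: `B(ρᵢ)` minus column `j` of full column rank at EVERY root) — the obstruction recorded in
`NOGO-LEDGER-KERNEL-liftp2g20.md` §4 («OPEN for the corner graft … an explicit sharp family whose kernel vector at every positive root has a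
non-zero PINNED coordinate»).  THIS FILE removes it with no new family:

* §1 `exists_moment_ne_zero` — finitely many nonzero vectors `uᵢ ∈ ℝ^{q+1}` avoid one moment hyperplane `{x : Σ_k c^k x_k = 0}` (each
  `Σ_k uᵢ,ₖ X^k ≠ 0` has finitely many roots; `ℝ` is infinite); `det_mixMatrix` — the unipotent mixing `P_c` (first row `(1, −c, …, −c^q)`,
  identity below) has determinant `1`; `exists_kernel_generator` — a singular square matrix with one full-rank column-deletion has a
  one-dimensional kernel `ℝ·u`; **`gram_det_mul_mix_ne_zero`** — if the moment functional of `c` does not vanish at `u` then `A·P_c` minus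
  column `0` has full column rank (the columns `e_{k+1} − c^{k+1}e₀` of `P_c` span exactly the moment hyperplane, which meets `ℝ·u` in `0`).
* §2 **`skewBlock_cornerGraft_of_sharp`** — ROOT COUNTING SUFFICES FOR THE CORNER: a square block pencil `B(X) = Σ X^{dₗ}Bₗ` with `det B ≠ 0`
  Descartes-sharp (`#supp(det B) ≤ Z₊(det B) + 1`) admits ONE mixing `P` (`det P = 1`: the blocks `Bₗ·P` have the same support and the same
  determinant) such that for EVERY exponent `D` some `η > 0` gives, for the symmetric skew-block pencil `G_η` built on the blocks `Bₗ·P`: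
  `Z₊(det G_η) = 0`, `Z₊(det (G_η)″) = 0` (principal minor at the corner `inr 0`) and `Z₊(det(G_η + X^D·E_{inr 0})) ≥ 2·Z₊(det B)`.
  (p689545 needs no rescaling and no largeness of `D`: the corner crossing is first order in `η`.)

Fed with the tree's Descartes-sharp `(q+1, 3)` family this gives `(q+1)(q+4) = m²/4 + 3m/2` corner phantoms with BOTH digits rootless at every
even `m`, every exponent, also inside `IsTower` — the companion file `…SkewBlockCornerGraftSharp.lean`.
READING (NO-GO ledger, kill-shape #38⁺): the row «additive term `o(ζ₊) = o(m²)` for an instance-level CORNER law `Z₊(h) ≤ c·(Z₊(A) + Z₊(E)) + g`»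
goes LOCATED → KERNEL; still inside the class budget (`B ≥ ζ₊ ≥ C(m+2,2) − 1`): ZERO crux credit, S4b at `C = 1` pays.
HONEST FRAMING: linear algebra (a generic hyperplane) on top of p689545 / p704766; nothing on S4/S4b/S5/S5ᴸ, TowerB, `WeakLifting`,
Conjecture B, `MatrixDescartes` (18050) or `VP ≠ VNP`.  Def-free.  Seat: prover val-sym-lift-p2 g21, `--supports stmt-ValiantsHypothesis-19561`.
-/

-- `Summit.ValiantsHypothesis.ValiantsHypothesis.…` repeats a component by the D-0017 layout
-- (single-conjunct summit), which the `dupNamespace` linter flags; the name is mandated.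
set_option linter.dupNamespace false

namespace Summit.ValiantsHypothesis.ValiantsHypothesis.Theorems.KPlusLogSqLaw.TowerGraft

open Polynomial Matrix
open scoped BigOperators Polynomial

/-! ## §1 The unipotent column mixing -/

section CornerMixing

variable {q : ℕ}


/-- **generic functional**: finitely many nonzero real vectors avoid a common hyperplane of the moment form `x ↦ Σ_k c^k x_k` for some
real `c` (each `Σ_k u_k X^k ≠ 0` has finitely many roots). [folklore] -/
theorem exists_moment_ne_zero (N : ℕ) (u : ℕ → Fin (q + 1) → ℝ) (hu : ∀ i, i < N → u i ≠ 0) :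
    ∃ c : ℝ, ∀ i, i < N → ∑ k : Fin (q + 1), c ^ (k : ℕ) * u i k ≠ 0 := by
  classical
  -- the moment polynomials
  set p : ℕ → ℝ[X] := fun i => ∑ k : Fin (q + 1), monomial (k : ℕ) (u i k) with hp
  have hcoeff : ∀ i (k : Fin (q + 1)), (p i).coeff k = u i k := by
    intro i k
    simp only [hp, finsetSum_coeff, coeff_monomial]
    rw [Finset.sum_eq_single k]
    · simp
    · intro b _ hb
      rw [if_neg]
      exact fun h => hb (Fin.ext h)
    · intro h; exact absurd (Finset.mem_univ k) h
  have hp0 : ∀ i, i < N → p i ≠ 0 := by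
    intro i hi h0
    apply hu i hi
    funext k
    have := hcoeff i k
    rw [h0, coeff_zero] at this
    exact this.symm
  have heval : ∀ i (c : ℝ), (p i).eval c = ∑ k : Fin (q + 1), c ^ (k : ℕ) * u i k := by
    intro i c
    simp only [hp, eval_finsetSum, eval_monomial]
    exact Finset.sum_congr rfl fun k _ => mul_comm _ _
  -- the finite bad set
  set S : Finset ℝ := (Finset.range N).biUnion fun i => (p i).roots.toFinset with hS
  obtain ⟨c, hc⟩ := Infinite.exists_notMem_finset S
  refine ⟨c, fun i hi h0 => hc ?_⟩
  rw [hS, Finset.mem_biUnion]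
  refine ⟨i, Finset.mem_range.mpr hi, ?_⟩
  rw [Multiset.mem_toFinset, mem_roots (hp0 i hi), IsRoot.def, heval]
  exact h0

/-- the UNIPOTENT MIXING MATRIX `P_c`: first row `(1, −c, −c², …, −c^q)`, identity below; written inline as
`Matrix.of fun i k => if i = k then 1 else if i = 0 then −c^k else 0`.  Its determinant is `1`. [folklore] -/
theorem det_mixMatrix (c : ℝ) :
    (Matrix.of fun i k : Fin (q + 1) => if i = k then (1 : ℝ) else if i = 0 then -(c ^ (k : ℕ)) else 0).det = 1 := by
  rw [Matrix.det_of_upperTriangular]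
  · simp
  · intro i j hij
    have h1 : i ≠ j := fun h => by rw [h] at hij; exact lt_irrefl _ hij
    have h2 : i ≠ 0 := fun h => by rw [h] at hij; exact (Fin.not_lt_zero j) hij
    simp [Matrix.of_apply, h1, h2]

/-- a column-deleted matrix with non-singular Gram matrix has injective `mulVec`. [folklore] -/
theorem mulVec_injective_of_gram_det_ne_zero {p : ℕ} (A : Matrix (Fin p) (Fin q) ℝ) (h : (Aᵀ * A).det ≠ 0) :
    Function.Injective A.mulVec := by
  intro v w hvw
  have h1 : (Aᵀ * A) *ᵥ v = (Aᵀ * A) *ᵥ w := by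
    rw [← Matrix.mulVec_mulVec, ← Matrix.mulVec_mulVec, hvw]
  exact (Matrix.mulVec_injective_iff_isUnit.mpr ((Matrix.isUnit_iff_isUnit_det _).mpr (isUnit_iff_ne_zero.mpr h))) h1

/-- **corank-one package**: a singular square matrix one of whose column-deleted submatrices has full column rank has a one-dimensional
kernel: a nonzero kernel vector `u` of which every kernel vector is a multiple. [folklore] -/
theorem exists_kernel_generator (A : Matrix (Fin (q + 1)) (Fin (q + 1)) ℝ) (hdet : A.det = 0)
    (hj : ∃ j : Fin (q + 1), ((A.submatrix id j.succAbove)ᵀ * A.submatrix id j.succAbove).det ≠ 0) :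
    ∃ u : Fin (q + 1) → ℝ, u ≠ 0 ∧ A *ᵥ u = 0 ∧ ∀ v, A *ᵥ v = 0 → ∃ r : ℝ, v = r • u := by
  obtain ⟨j, hj⟩ := hj
  have hinj := mulVec_injective_of_gram_det_ne_zero _ hj
  obtain ⟨u, hu0, hu⟩ := Matrix.exists_mulVec_eq_zero_iff.mpr hdet
  -- restriction to the coordinates off `j` of a kernel vector vanishing at `j` is a kernel vector of the column-deleted matrix
  have hrestr : ∀ w : Fin (q + 1) → ℝ, A *ᵥ w = 0 → w j = 0 → w = 0 := by
    intro w hw hwj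
    have h1 : (A.submatrix id j.succAbove) *ᵥ (fun k => w (j.succAbove k)) = 0 := by
      funext i
      have := congrFun hw i
      rw [Matrix.mulVec, dotProduct, Fin.sum_univ_succAbove _ j, hwj, mul_zero, zero_add] at this
      simpa [Matrix.mulVec, dotProduct, Matrix.submatrix_apply] using this
    have h2 : (fun k => w (j.succAbove k)) = 0 := hinj (by rw [h1, Matrix.mulVec_zero])
    funext k
    rcases Fin.eq_self_or_eq_succAbove j k with rfl | ⟨k', rfl⟩
    · exact hwj
    · exact congrFun h2 k'
  have huj : u j ≠ 0 := fun h => hu0 (hrestr u hu h)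
  refine ⟨u, hu0, hu, fun v hv => ⟨v j / u j, ?_⟩⟩
  have h3 : v - (v j / u j) • u = 0 := by
    refine hrestr _ ?_ ?_
    · rw [Matrix.mulVec_sub, Matrix.mulVec_smul, hv, hu, smul_zero, sub_zero]
    · simp [div_mul_cancel₀ _ huj]
  exact sub_eq_zero.mp h3

/-- **THE MIXING STEP**: if `A` has the one-dimensional kernel `ℝ·u` and the moment functional of `c` does not vanish at `u`, then
`A · P_c` minus its column `0` has full column rank (non-singular Gram matrix). [this work] -/
theorem gram_det_mul_mix_ne_zero (A : Matrix (Fin (q + 1)) (Fin (q + 1)) ℝ) (u : Fin (q + 1) → ℝ)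
    (hker : ∀ v, A *ᵥ v = 0 → ∃ r : ℝ, v = r • u) (c : ℝ) (hc : ∑ k : Fin (q + 1), c ^ (k : ℕ) * u k ≠ 0) :
    (((A * Matrix.of fun i k : Fin (q + 1) => if i = k then (1 : ℝ) else if i = 0 then -(c ^ (k : ℕ)) else 0).submatrix id
        (0 : Fin (q + 1)).succAbove)ᵀ *
      (A * Matrix.of fun i k : Fin (q + 1) => if i = k then (1 : ℝ) else if i = 0 then -(c ^ (k : ℕ)) else 0).submatrix id
        (0 : Fin (q + 1)).succAbove).det ≠ 0 := by
  set P : Matrix (Fin (q + 1)) (Fin (q + 1)) ℝ :=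
    Matrix.of fun i k : Fin (q + 1) => if i = k then (1 : ℝ) else if i = 0 then -(c ^ (k : ℕ)) else 0 with hP
  set P' : Matrix (Fin (q + 1)) (Fin q) ℝ := P.submatrix id (0 : Fin (q + 1)).succAbove with hP'
  have hsub : (A * P).submatrix id (0 : Fin (q + 1)).succAbove = A * P' := by
    rw [hP', Matrix.submatrix_mul _ _ (id : Fin (q + 1) → Fin (q + 1)) _ _ Function.bijective_id, Matrix.submatrix_id_id]
  rw [hsub]
  -- coordinates of `P' *ᵥ z`
  have hP'succ : ∀ (z : Fin q → ℝ) (i : Fin q), (P' *ᵥ z) (Fin.succ i) = z i := by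
    intro z i
    simp only [hP', hP, Matrix.mulVec, dotProduct, Matrix.submatrix_apply, id, Matrix.of_apply, Fin.succAbove_zero,
      Fin.succ_inj, Fin.succ_ne_zero]
    rw [Finset.sum_eq_single i]
    · simp
    · intro b _ hb; simp [Ne.symm hb]
    · intro h; exact absurd (Finset.mem_univ i) h
  have hP'zero : ∀ z : Fin q → ℝ, (P' *ᵥ z) 0 = -∑ i : Fin q, c ^ ((i : ℕ) + 1) * z i := by
    intro z
    simp only [hP', hP, Matrix.mulVec, dotProduct, Matrix.submatrix_apply, id, Matrix.of_apply, Fin.succAbove_zero,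
      (Fin.succ_ne_zero _).symm, if_false, if_true, Fin.val_succ]
    rw [← Finset.sum_neg_distrib]
    exact Finset.sum_congr rfl fun i _ => by ring
  -- the moment functional kills the range of `P'`
  have hmoment : ∀ z : Fin q → ℝ, ∑ k : Fin (q + 1), c ^ (k : ℕ) * (P' *ᵥ z) k = 0 := by
    intro z
    rw [Fin.sum_univ_succ, hP'zero]
    simp only [Fin.val_zero, pow_zero, one_mul, Fin.val_succ, hP'succ]
    rw [neg_add_eq_zero]
  -- injectivity of `A * P'`
  have hinj : Function.Injective (A * P').mulVec := by
    intro x y hxy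
    have h0 : A *ᵥ (P' *ᵥ (x - y)) = 0 := by
      rw [Matrix.mulVec_mulVec, Matrix.mulVec_sub, hxy, sub_self]
    obtain ⟨r, hr⟩ := hker _ h0
    have h1 : r * ∑ k : Fin (q + 1), c ^ (k : ℕ) * u k = 0 := by
      have := hmoment (x - y)
      rw [hr] at this
      simpa [Finset.mul_sum, Pi.smul_apply, smul_eq_mul, mul_left_comm] using this
    have hr0 : r = 0 := by
      rcases mul_eq_zero.mp h1 with h | h
      · exact h
      · exact absurd h hc
    rw [hr0, zero_smul] at hr
    funext i
    have := hP'succ (x - y) i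
    rw [hr, Pi.zero_apply] at this
    have : (x - y) i = 0 := this.symm
    exact sub_eq_zero.mp this
  have hpd := Matrix.PosDef.conjTranspose_mul_self _ hinj
  rw [Matrix.conjTranspose_eq_transpose_of_trivial] at hpd
  exact hpd.det_pos.ne'


end CornerMixing

/-! ## §2 Root counting suffices for the corner graft -/

section CornerGraftSharp

variable {q : ℕ}

/-- the block pencil of the mixed blocks `B_l · P` is the mixed block pencil `B(t) · P`. [folklore] -/
theorem sum_smul_mul_right {K p : ℕ} (d : Fin K → ℕ) (B : Fin K → Matrix (Fin p) (Fin (q + 1)) ℝ)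
    (P : Matrix (Fin (q + 1)) (Fin (q + 1)) ℝ) (t : ℝ) :
    (∑ l, t ^ d l • (B l * P)) = (∑ l, t ^ d l • B l) * P := by
  rw [Matrix.sum_mul]
  exact Finset.sum_congr rfl fun l _ => (Matrix.smul_mul _ _ _).symm

/-- **ROOT COUNTING SUFFICES FOR THE CORNER GRAFT.**  A square block pencil `B(X) = Σ X^{dₗ}Bₗ` whose determinant is Descartes-sharp
(`det B ≠ 0`, `#supp(det B) ≤ Z₊(det B) + 1`) gives, after a unipotent column mixing `Bₗ ↦ Bₗ·P` (`det P = 1`: same support, same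
determinant, same roots; ONE mixing for all exponents) and for EVERY far exponent `D`, corner-graft phantoms at the corner `inr 0` of the negative block:
`Z₊(det G_η) = 0`, `Z₊(det (G_η)″) = 0` (the principal minor at the corner) and `Z₊(det(G_η + X^D·E)) ≥ 2·Z₊(det B)` for some `η > 0`.
Mechanism: p704766 (sharp ⇒ simple ⇒ corank one ⇒ some column survives at each root) + the mixing of §1 (one column for all roots) +
p689545 `skewBlock_phantoms_square`. [this work] -/
theorem skewBlock_cornerGraft_of_sharp {K : ℕ} (d : Fin K → ℕ) (l₀ : Fin K) (B : Fin K → Matrix (Fin (q + 1)) (Fin (q + 1)) ℝ)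
    (hdet : (∑ l, (X : ℝ[X]) ^ d l • (B l).map C).det ≠ 0)
    (hsharp : (∑ l, (X : ℝ[X]) ^ d l • (B l).map C).det.support.card ≤
      ((∑ l, (X : ℝ[X]) ^ d l • (B l).map C).det.roots.toFinset.filter (fun t => 0 < t)).card + 1) :
    ∃ P : Matrix (Fin (q + 1)) (Fin (q + 1)) ℝ, P.det = 1 ∧ ∀ D : ℕ, ∃ η : ℝ, 0 < η ∧
      ((∑ l, (X : ℝ[X]) ^ d l • (Matrix.fromBlocks (if l = l₀ then η • (1 : Matrix (Fin (q + 1)) (Fin (q + 1)) ℝ) else 0)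
        (B l * P) (B l * P)ᵀ (if l = l₀ then -(η • (1 : Matrix (Fin (q + 1)) (Fin (q + 1)) ℝ)) else 0)).map C).det.roots.toFinset.filter
        (fun t => 0 < t)).card = 0 ∧
      (((∑ l, (X : ℝ[X]) ^ d l • (Matrix.fromBlocks (if l = l₀ then η • (1 : Matrix (Fin (q + 1)) (Fin (q + 1)) ℝ) else 0)
        (B l * P) (B l * P)ᵀ (if l = l₀ then -(η • (1 : Matrix (Fin (q + 1)) (Fin (q + 1)) ℝ)) else 0)).map C).submatrix
        (Sum.map id (0 : Fin (q + 1)).succAbove) (Sum.map id (0 : Fin (q + 1)).succAbove)).det.roots.toFinset.filter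
        (fun t => 0 < t)).card = 0 ∧
      2 * ((∑ l, (X : ℝ[X]) ^ d l • (B l).map C).det.roots.toFinset.filter (fun t => 0 < t)).card ≤
        ((((∑ l, (X : ℝ[X]) ^ d l • (Matrix.fromBlocks (if l = l₀ then η • (1 : Matrix (Fin (q + 1)) (Fin (q + 1)) ℝ) else 0)
          (B l * P) (B l * P)ᵀ (if l = l₀ then -(η • (1 : Matrix (Fin (q + 1)) (Fin (q + 1)) ℝ)) else 0)).map C) +
        (X : ℝ[X]) ^ D • Matrix.single (Sum.inr 0 : Fin (q + 1) ⊕ Fin (q + 1)) (Sum.inr 0) (1 : ℝ[X])).det).roots.toFinset.filter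
        (fun t => 0 < t)).card := by
  classical
  set M : Matrix (Fin (q + 1)) (Fin (q + 1)) ℝ[X] := ∑ l, (X : ℝ[X]) ^ d l • (B l).map C with hM
  set f : ℝ[X] := M.det with hf
  set R : Finset ℝ := f.roots.toFinset.filter (fun t => 0 < t) with hR
  set N : ℕ := R.card with hN
  have hmemR : ∀ x : ℝ, x ∈ R ↔ f.eval x = 0 ∧ 0 < x := fun x => by
    simp only [hR, Finset.mem_filter, Multiset.mem_toFinset, Polynomial.mem_roots hdet, Polynomial.IsRoot.def]
  have hfeval : ∀ t : ℝ, f.eval t = (∑ l, t ^ d l • B l).det := fun t => by rw [hf, hM, eval_det_pencil_of_fintype]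
  -- the sorted positive roots, extended to a strictly increasing sequence on `ℕ` (as in `skewBlock_identityGraft_of_sharp`)
  set e := R.orderEmbOfFin hN.symm with he
  set M₀ : ℝ := ∑ x ∈ R, x with hM₀
  have hRpos : ∀ x ∈ R, 0 < x := fun x hx => ((hmemR x).mp hx).2
  have hM₀ge : ∀ x ∈ R, x ≤ M₀ := fun x hx =>
    Finset.single_le_sum (f := fun x => x) (fun y hy => (hRpos y hy).le) hx
  have hM₀nn : 0 ≤ M₀ := Finset.sum_nonneg fun y hy => (hRpos y hy).le
  set ρ : ℕ → ℝ := fun i => if h : i < N then e ⟨i, h⟩ else M₀ + ((i + 1 - N : ℕ) : ℝ) with hρ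
  have hρe : ∀ (i : ℕ) (h : i < N), ρ i = e ⟨i, h⟩ := fun i h => by simp only [hρ, dif_pos h]
  have hρmem : ∀ (i : ℕ), i < N → ρ i ∈ R := fun i h => by rw [hρe i h]; exact Finset.orderEmbOfFin_mem _ _ _
  have hρstep : ∀ i, ρ i < ρ (i + 1) := by
    intro i
    by_cases h1 : i + 1 < N
    · rw [hρe i (by omega), hρe (i + 1) h1]
      exact e.strictMono (Fin.mk_lt_mk.mpr (Nat.lt_succ_self i))
    · by_cases h2 : i < N
      · rw [hρe i h2]
        simp only [hρ, dif_neg h1]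
        have : (i + 1 + 1 - N : ℕ) = 1 := by omega
        rw [this, Nat.cast_one]
        linarith [hM₀ge _ (Finset.orderEmbOfFin_mem R hN.symm ⟨i, h2⟩)]
      · simp only [hρ, dif_neg h1, dif_neg h2]
        have : ((i + 1 + 1 - N : ℕ) : ℝ) = ((i + 1 - N : ℕ) : ℝ) + 1 := by
          rw [show (i + 1 + 1 - N : ℕ) = (i + 1 - N) + 1 by omega]; push_cast; ring
        rw [this]; linarith
  have hρmono : StrictMono ρ := strictMono_nat_of_lt_succ hρstep
  have hρ0 : 0 < ρ 0 := by
    by_cases h : 0 < N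
    · exact hRpos _ (hρmem 0 h)
    · simp only [hρ, dif_neg h]
      have : (0 + 1 - N : ℕ) = 1 := by omega
      rw [this, Nat.cast_one]; linarith
  have hρpos : ∀ i, 0 < ρ i := fun i => lt_of_lt_of_le hρ0 (hρmono.monotone (Nat.zero_le i))
  set τ : ℕ → ℝ := fun i => if i = 0 then ρ 0 / 2 else (ρ (i - 1) + ρ i) / 2 with hτ
  have hτ0 : τ 0 = ρ 0 / 2 := by simp [hτ]
  have hτS : ∀ i, τ (i + 1) = (ρ i + ρ (i + 1)) / 2 := fun i => by simp [hτ]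
  have hτρ : ∀ i, τ i < ρ i := by
    intro i
    rcases i with _ | i
    · rw [hτ0]; linarith [hρ0]
    · rw [hτS]; linarith [hρstep i]
  have hρτ : ∀ i, ρ i < τ (i + 1) := fun i => by rw [hτS]; linarith [hρstep i]
  have hτpos : ∀ i, 0 < τ i := by
    intro i
    rcases i with _ | i
    · rw [hτ0]; linarith [hρ0]
    · rw [hτS]; linarith [hρpos i, hρpos (i + 1)]
  have hτB : ∀ i, i ≤ N → (∑ l, τ i ^ d l • B l).det ≠ 0 := by
    intro i hi h0
    have hmem : τ i ∈ R := (hmemR _).mpr ⟨by rw [hfeval]; exact h0, hτpos i⟩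
    obtain ⟨j, hj⟩ : ∃ j : Fin N, e j = τ i := by
      have : τ i ∈ Set.range e := by rw [he, Finset.range_orderEmbOfFin]; exact hmem
      exact this
    rcases i with _ | i
    · have h1 : e ⟨0, j.pos⟩ ≤ e j := e.monotone (Fin.mk_le_mk.mpr (Nat.zero_le _))
      rw [hj, ← hρe 0 j.pos] at h1
      linarith [hτρ 0]
    · have hlo : ρ i < e j := by rw [hj]; exact hρτ i
      have hhi : e j < ρ (i + 1) := by rw [hj]; exact hτρ (i + 1)
      rw [hρe i (by omega)] at hlo
      have hij : (⟨i, by omega⟩ : Fin N) < j := e.lt_iff_lt.mp hlo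
      by_cases h2 : i + 1 < N
      · rw [hρe (i + 1) h2] at hhi
        have hji : j < ⟨i + 1, h2⟩ := e.lt_iff_lt.mp hhi
        rw [Fin.lt_def] at hij hji
        simp only at hij hji
        omega
      · have := j.isLt
        rw [Fin.lt_def] at hij
        simp only at hij
        omega
  have hρB : ∀ i, i < N → (∑ l, ρ i ^ d l • B l).det = 0 := fun i hi => by
    rw [← hfeval]; exact ((hmemR _).mp (hρmem i hi)).1
  -- a kernel generator at every root (sharp ⇒ some column-deleted matrix has full rank ⇒ corank one)
  have hgen : ∀ i, i < N → ∃ u : Fin (q + 1) → ℝ, u ≠ 0 ∧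
      ∀ v, (∑ l, ρ i ^ d l • B l) *ᵥ v = 0 → ∃ r : ℝ, v = r • u := by
    intro i hi
    have h := exists_gram_det_ne_zero_of_sharp M hdet hsharp (hρpos i) (by
      rw [Polynomial.IsRoot.def, ← hf]; exact ((hmemR _).mp (hρmem i hi)).1)
    rw [hM, lacunaryPencil_map_eval] at h
    obtain ⟨u, hu0, -, hker⟩ := exists_kernel_generator _ (hρB i hi) h
    exact ⟨u, hu0, hker⟩
  -- choose the generators, then one moment functional avoiding all of them
  set U : ℕ → Fin (q + 1) → ℝ := fun i => if h : i < N then Classical.choose (hgen i h) else fun _ => 1 with hU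
  have hU0 : ∀ i, i < N → U i ≠ 0 := fun i hi => by
    simp only [hU, dif_pos hi]; exact (Classical.choose_spec (hgen i hi)).1
  have hUker : ∀ i, i < N → ∀ v, (∑ l, ρ i ^ d l • B l) *ᵥ v = 0 → ∃ r : ℝ, v = r • U i := fun i hi => by
    simp only [hU, dif_pos hi]; exact (Classical.choose_spec (hgen i hi)).2
  obtain ⟨c, hc⟩ := exists_moment_ne_zero N U hU0
  set P : Matrix (Fin (q + 1)) (Fin (q + 1)) ℝ :=
    Matrix.of fun i k : Fin (q + 1) => if i = k then (1 : ℝ) else if i = 0 then -(c ^ (k : ℕ)) else 0 with hP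
  have hPdet : P.det = 1 := det_mixMatrix c
  -- the mixed block pencil: same determinant, full column rank off column `0` at every root
  have hmix : ∀ t : ℝ, (∑ l, t ^ d l • (B l * P)) = (∑ l, t ^ d l • B l) * P := fun t => sum_smul_mul_right d B P t
  have hτB' : ∀ i, i ≤ N → (∑ l, τ i ^ d l • (B l * P)).det ≠ 0 := fun i hi => by
    rw [hmix, Matrix.det_mul, hPdet, mul_one]; exact hτB i hi
  have hρB' : ∀ i, i < N → (∑ l, ρ i ^ d l • (B l * P)).det = 0 := fun i hi => by
    rw [hmix, Matrix.det_mul, hρB i hi, zero_mul]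
  have hρB'' : ∀ i, i < N → (((∑ l, ρ i ^ d l • (B l * P)).submatrix id (0 : Fin (q + 1)).succAbove)ᵀ *
      ((∑ l, ρ i ^ d l • (B l * P)).submatrix id (0 : Fin (q + 1)).succAbove)).det ≠ 0 := fun i hi => by
    rw [hmix]
    exact gram_det_mul_mix_ne_zero _ (U i) (hUker i hi) c (hc i hi)
  refine ⟨P, hPdet, fun D => ?_⟩
  obtain ⟨η, hη, h1, h2, h3⟩ := skewBlock_phantoms_square d l₀ D (fun l => B l * P) 0 N τ ρ hτρ hρτ hτpos hτB' hρB' hρB''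
  exact ⟨η, hη, h1, h2, h3⟩

end CornerGraftSharp

end Summit.ValiantsHypothesis.ValiantsHypothesis.Theorems.KPlusLogSqLaw.TowerGraft
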